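import Summits.CriticalPhenomena.CardyFormulaZ2.Theorems.CardyMagicRigidityMarkovCascadeDefs
import Literature.Probability.Percolation.FKLoopNestingIntegrable
import Literature.Probability.Percolation.InterfaceLoopClusters
import Literature.Probability.Percolation.CLE6Proofs
import HarnessLib

/-!
# Both closed-b.c. domain ensembles live within `δ` of the domain (line `markov-cascade-one-generation`, crux `NestingRigidity`)

Crux `Summit.CriticalPhenomena.CardyFormulaZ2.Theses.CardyMagicRigidity.NestingRigidity`
(stmt-CriticalPhenomena-4835), line `markov-cascade-one-generation`; helper lemmas toward stub
`stub_kernelUniqueness : KernelUniqueness` (S4) and `stub_cascadeReconstruction` /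
`stub_windowLocality` over the definitions module `CardyMagicRigidityMarkovCascadeDefs`
(`meshEdges`, `domLoopsZ2`, `domLoopsT`).  Closed lattice geometry, no hypothesis of the crux:

* `range_subset_cthickening_of_mem_domLoopsZ2` — every loop of the RESTRICTED `ℤ²` ensemble
  `domLoopsZ2 U δ ω` (interface loops of `ω ∩ meshEdges U δ` visiting an edge of `U_δ`, the gen-2
  revision of the skeleton) has its trace in the closed `δ/2`-thickening of `U`: the left vertex of
  the dart through that edge is in `U`, the left vertices of all darts lie in one open cluster of the
  restricted configuration (`IsInterfaceLoop.reachable_left`), whose vertices are all in `U`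
  (`meshPoint_mem_of_reachable`), and every trace point is within `δ/2` of such a vertex
  (`exists_left_dist_le_mesh`, localisation at mesh `δ`).  So the exterior-diamond carpet of the
  unrestricted ensemble is indeed gone, and symmetrically
* `range_subset_cthickening_of_mem_domLoopsT` — every loop of the `𝕋` ensemble `domLoopsT U δ ω` has
  its trace in the closed `δ`-thickening of `U` (an open site of `U_δ` on the left of every dart).
These are the two containments used by the `d_CN` comparisons `KernelTransfer` / `DomainLawTransfer`
("nothing outside `B(0, R + δ)` on either side") and by the soup-matching audit of S4.
-/

noncomputable section

open MeasureTheory Set Filter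
open scoped Topology BigOperators ENNReal Real

namespace Summit.CriticalPhenomena.CardyFormulaZ2.Cruxes.NestingRigidity.MarkovCascadeOneGeneration

open Literature.Probability.RandomPlanarGeometry Literature.Probability.Percolation
  Literature.Probability.LatticeModels Metric

/-! ## Both closed-b.c. domain ensembles live within `δ` of the domain -/

/-- Mesh points scale linearly with the mesh. -/
theorem meshPoint_eq_mul_meshPoint_one (δ : ℝ) (x : Site 2) :
    meshPoint δ x = (δ : ℂ) * meshPoint 1 x := by
  simp [meshPoint]

/-- Medial points scale linearly with the mesh. -/
theorem medialPoint_eq_mul_medialPoint_one (δ : ℝ) (e : MedialVertex) :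
    medialPoint δ e = (δ : ℂ) * medialPoint 1 e := by
  induction e using Sym2.ind with
  | _ x y =>
    rw [medialPoint_mk, medialPoint_mk, meshPoint_eq_mul_meshPoint_one δ x,
      meshPoint_eq_mul_meshPoint_one δ y]
    ring

/-- Distances between lattice points drawn at mesh `δ` are `|δ|` times those at mesh `1`. -/
theorem dist_mul_mul_eq (δ : ℝ) (a b : ℂ) : dist ((δ : ℂ) * a) ((δ : ℂ) * b) = |δ| * dist a b := by
  rw [dist_eq_norm, ← mul_sub, norm_mul, Complex.norm_real, Real.norm_eq_abs, ← dist_eq_norm]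

/-- At mesh `δ` the midpoint of the source edge of a corner is at distance `|δ|/2` from its left
vertex. -/
theorem dist_medialPoint_cSrc_mesh (δ : ℝ) (p : Site 2 × Fin 4) :
    dist (medialPoint δ (cSrc p)) (meshPoint δ p.1) = |δ| / 2 := by
  rw [medialPoint_eq_mul_medialPoint_one, meshPoint_eq_mul_meshPoint_one δ, dist_mul_mul_eq,
    dist_medialPoint_cSrc]
  ring

/-- At mesh `δ` the midpoint of the target edge of a corner is at distance `|δ|/2` from its left
vertex. -/
theorem dist_medialPoint_cTgt_mesh (δ : ℝ) (p : Site 2 × Fin 4) :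
    dist (medialPoint δ (cTgt p)) (meshPoint δ p.1) = |δ| / 2 := by
  rw [medialPoint_eq_mul_medialPoint_one, meshPoint_eq_mul_meshPoint_one δ, dist_mul_mul_eq,
    dist_medialPoint_cTgt]
  ring

/-- **Localisation at mesh `δ`**: every point of the trace of an interface loop drawn at mesh `δ`
is within `|δ|/2` of the left vertex of one of its darts (the trace is the union of the dart
segments, `range_loopCurve_zero`; both ends of the segment of the dart with corner `p` are at
distance `|δ|/2` from `δ p.1`). The mesh-`1` case is `IsInterfaceLoop.exists_left_dist_le`. -/
theorem exists_left_dist_le_mesh {ω : BondConfig (Site 2)} {γ : List MedialVertex}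
    (h : IsInterfaceLoop ω γ) (δ : ℝ) {x : ℂ} (hx : x ∈ (loopCurve δ 0 γ).range) :
    ∃ p : Site 2 × Fin 4, (cSrc p, cTgt p) ∈ γ.zip (γ.rotate 1) ∧
      dist x (meshPoint δ p.1) ≤ |δ| / 2 := by
  rw [range_loopCurve_zero δ h.ne_nil] at hx
  simp only [Set.mem_iUnion, exists_prop] at hx
  obtain ⟨⟨e, e'⟩, hq, hx⟩ := hx
  obtain ⟨p, hps, hpt⟩ := isMedialDart_iff_exists_corner.1 (h.isMedialDart_of_mem_zip hq)
  refine ⟨p, by rwa [hps, hpt], ?_⟩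
  have hsub : segment ℝ (medialPoint δ e) (medialPoint δ e') ⊆
      closedBall (meshPoint δ p.1) (|δ| / 2) := by
    refine (convex_closedBall _ _).segment_subset ?_ ?_
    · rw [mem_closedBall, ← hps]
      exact (dist_medialPoint_cSrc_mesh δ p).le
    · rw [mem_closedBall, ← hpt]
      exact (dist_medialPoint_cTgt_mesh δ p).le
  exact mem_closedBall.1 (hsub hx)

/-- **Open paths of the closed-b.c. configuration stay in `U`**: a vertex joined to a vertex of
`U_δ` by open lattice edges of `ω ∩ meshEdges U δ` is a vertex of `U_δ` (every open edge has both
endpoints in `U`). -/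
theorem meshPoint_mem_of_reachable {U : Set ℂ} {δ : ℝ} {ω : BondConfig (Site 2)} {x y : Site 2}
    (hx : meshPoint δ x ∈ U) (h : (openGraph (ω ∩ meshEdges U δ) ⊓ zdGraph 2).Reachable x y) :
    meshPoint δ y ∈ U := by
  obtain ⟨w⟩ := h
  revert hx
  induction w with
  | nil => exact id
  | cons hadj _ ih =>
    intro _
    refine ih ?_
    have hmem := ((openGraph_adj _ _ _).1 ((SimpleGraph.inf_adj _ _ _ _).1 hadj).1).1
    exact hmem.2 _ (Sym2.mem_mk_right _ _)

/-- **The `ℤ²` closed-b.c. domain ensemble lives within `δ/2` of `U`** (`δ ≥ 0`): every loop of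
`domLoopsZ2 U δ ω` passes through the midpoint of an edge of `U_δ`, so the left vertex of that dart
is in `U`; the left vertices of all its darts lie in one open cluster of `ω ∩ meshEdges U δ`
(`IsInterfaceLoop.reachable_left`), hence in `U` (`meshPoint_mem_of_reachable`); and every point of
the trace is within `δ/2` of such a left vertex (`exists_left_dist_le_mesh`). This is the formal
content of the gen-2 restriction of `domLoopsZ2`: no loop of the restricted ensemble is farther
than `δ/2` from `U` (the exterior carpet is gone), symmetrically with the `𝕋` side below. -/
theorem range_subset_cthickening_of_mem_domLoopsZ2 : ∀ {U : Set ℂ} {δ : ℝ}, 0 ≤ δ →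
    ∀ {ω : BondConfig (Site 2)} {u : UnbasedLoop ℂ}, u ∈ (domLoopsZ2 U δ ω).loops →
      u.range ⊆ Metric.cthickening (δ / 2) U := by
  intro U δ hδ ω u hu
  have key : ∀ i : Fin 2, u ∈ (domLoopsZ2 U δ ω).F i → u.range ⊆ cthickening (δ / 2) U := by
    rintro i ⟨γ, h, -, ⟨e, heγ, heM⟩, rfl⟩ x hx
    rw [UnbasedLoop.range_mk, BasedLoop.toCurveClass_mk] at hx
    -- the dart of `γ` whose source edge is `e`, and its corner `p₀`, whose vertex is in `U`
    obtain ⟨j, hj, rfl⟩ := List.mem_iff_getElem.1 heγ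
    obtain ⟨p₀, hps, hpt⟩ := h.exists_corner j
    have hp₀ : (cSrc p₀, cTgt p₀) ∈ γ.zip (γ.rotate 1) := by
      rw [hps, hpt]; exact h.getElem_mod_mem_zip j
    have hp₀U : meshPoint δ p₀.1 ∈ U := by
      have hsrc : cSrc p₀ = γ[j] := by
        rw [hps]; exact IsInterfaceLoop.getElem_idx_congr (Nat.mod_eq_of_lt hj) _
      have hmem : p₀.1 ∈ cSrc p₀ := Sym2.mem_mk_left _ _
      rw [hsrc] at hmem
      exact heM _ hmem
    -- localisation and connectedness of the rim
    obtain ⟨q, hq, hdist⟩ := exists_left_dist_le_mesh h δ hx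
    rw [abs_of_nonneg hδ] at hdist
    exact mem_cthickening_of_dist_le x (meshPoint δ q.1) (δ / 2) U
      (meshPoint_mem_of_reachable hp₀U (h.reachable_left hp₀ hq)) hdist
  rcases LoopConfig.mem_loops_iff.1 hu with h0 | h1
  exacts [key 0 h0, key 1 h1]

/-- **The `𝕋` closed-b.c. domain ensemble lives within `δ` of `U`** (`δ ≥ 0`): every dart of a
honeycomb interface loop of `ω ∩ triMeshVertices U δ` has an open site of `U_δ` on its left, within
`δ` of both ends of its segment (`segment_subset_cthickening_of_isSiteInterfaceLoop`). -/
theorem range_subset_cthickening_of_mem_domLoopsT : ∀ {U : Set ℂ} {δ : ℝ}, 0 ≤ δ →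
    ∀ {ω : SiteConfig (Site 2)} {u : UnbasedLoop ℂ}, u ∈ (domLoopsT U δ ω).loops →
      u.range ⊆ Metric.cthickening δ U := by
  intro U δ hδ ω u hu
  have key : ∀ i : Fin 2, u ∈ (domLoopsT U δ ω).F i → u.range ⊆ cthickening δ U := by
    intro i hui
    change u ∈ (siteLoopConfig δ (ω ∩ triMeshVertices U δ)).F i at hui
    obtain ⟨v, γ, hγ, -, rfl⟩ := mem_siteLoopConfig_iff.1 hui
    rw [UnbasedLoop.range_mk, BasedLoop.toCurveClass_mk]
    change Set.range (γ.toCurve fun v ↦ (δ : ℂ) * hexCenter v) ⊆ cthickening δ U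
    exact SimpleGraph.Walk.range_toCurve_subset_of_not_nil hγ.isCycle.not_nil
      fun d hd ↦ segment_subset_cthickening_of_isSiteInterfaceLoop hδ hγ hd
  rcases LoopConfig.mem_loops_iff.1 hu with h0 | h1
  exacts [key 0 h0, key 1 h1]

end Summit.CriticalPhenomena.CardyFormulaZ2.Cruxes.NestingRigidity.MarkovCascadeOneGeneration

end
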